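import Summits.FinalStateConjecture.FinalStateConjecture.Theorems.EIHFluxBalanceInertialRecessionStubSlavingCOERLieKernel

/-!
# Route EIHFluxBalance — `InertialRecession` (E′), stub `stub_frozenVacuumSlaving`:
# kinematic bridge from the rest-frame conclusions of the four-event rigidity to the painted jets

Helper file for the crux `stmt-FinalStateConjecture-17403`
(`Summit.FinalStateConjecture.FinalStateConjecture.Theses.EIHFluxBalance.InertialRecession`, E′),
stub `stub_frozenVacuumSlaving`, roadmap `FVS_momentum_roadmap.md` step (P8). The rigidity
theorems of `…StubSlavingCOERLieKernel` / `…StubSlavingCOERSymbolLab` conclude, for a motion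
`(Λ(s), c(s))` whose first variation vanishes at four events, that the rest-frame spatial parts of
`D u₀` (`D = d/ds Λ⁻¹`, `u₀ = Λ₀ e₀`) and of `Λ₀⁻¹ ċ` vanish. Here these are translated into the
painted jets of `SLAVED³`: the painted velocity `u = Λ e₀` has `u̇ = 0`, and `ċ ∥ u`.

* `minkowski_vel_deriv_vel_eq_zero` — `η(u, u̇) = 0` along a motion (`η(u,u) = −1`);
* `lorentz_symm_deriv_vel_apply_zero` — `(Λ₀⁻¹ u̇)⁰ = 0`: the rest-frame image of `u̇` is spatial;
* `deriv_symm_vel_eq_neg` — `D u₀ = −Λ₀⁻¹ u̇` (differentiate `Λ⁻¹(Λ e₀) = e₀`);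
* `deriv_vel_eq_zero_of_spatial_eq_zero` — **`(D u₀)⃗ = 0 ⇒ u̇ = 0`**;
* `eq_smul_vel_of_spatial_symm_eq_zero` — **`(Λ₀⁻¹ ċ)⃗ = 0 ⇒ ċ = ċ⁰/u⁰ · u`** (the centre moves
  with the painted velocity: `ξ̇ = v(Λ)`);
* `deriv_vel_eq_zero_and_of_deriv_boostedKerrBilin_eq_zero_four_events` — assembled with
  `spatial_eq_zero_of_deriv_boostedKerrBilin_eq_zero_four_events`.

Elementary; no definitions, no named facts, no `sorry`.
-/

set_option linter.dupNamespace false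
set_option maxSynthPendingDepth 3

noncomputable section

open Set Function Literature.Geometry.Lorentzian
open scoped InnerProductSpace

namespace Summit.FinalStateConjecture.FinalStateConjecture.Theorems.SublinearIsFree.Slaving

section Kinematics

variable {Λ : ℝ → lorentzGroup} {s₀ : ℝ} {D : E4 →L[ℝ] E4} {udot : E4}

/-- `η(Λe₀, Λe₀) = η(e₀, e₀) = −1` for `Λ ∈ O(1,3)`. [cite: ONeill1983, Ch. 9, p. 233] -/
theorem minkowski_vel_self (Λ : lorentzGroup) :
    Minkowski.bilin ((Λ : E4 ≃L[ℝ] E4) (E4.ofTimeSpace 1 0)) ((Λ : E4 ≃L[ℝ] E4) (E4.ofTimeSpace 1 0))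
      = -1 := by
  rw [Λ.2]
  simp

/-- **`η(u, u̇) = 0`** along a motion: differentiate `η(u(s), u(s)) = −1`. [cite: ONeill1983, Ch. 9, p. 233] -/
theorem minkowski_vel_deriv_vel_eq_zero
    (hu : HasDerivAt (fun s ↦ (Λ s : E4 ≃L[ℝ] E4) (E4.ofTimeSpace 1 0)) udot s₀) :
    Minkowski.bilin ((Λ s₀ : E4 ≃L[ℝ] E4) (E4.ofTimeSpace 1 0)) udot = 0 := by
  have hη := (((Minkowski.bilin : E4 →L[ℝ] E4 →L[ℝ] ℝ).hasFDerivAt).comp_hasDerivAt s₀ hu).clm_apply hu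
  have hconst : (fun s ↦ Minkowski.bilin ((Λ s : E4 ≃L[ℝ] E4) (E4.ofTimeSpace 1 0))
      ((Λ s : E4 ≃L[ℝ] E4) (E4.ofTimeSpace 1 0))) = fun _ ↦ (-1 : ℝ) := by
    funext s; exact minkowski_vel_self (Λ s)
  have hzero : HasDerivAt (fun s ↦ Minkowski.bilin ((Λ s : E4 ≃L[ℝ] E4) (E4.ofTimeSpace 1 0))
      ((Λ s : E4 ≃L[ℝ] E4) (E4.ofTimeSpace 1 0))) 0 s₀ := by
    rw [hconst]; exact hasDerivAt_const s₀ _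
  have heq := hη.unique hzero
  simp only [Function.comp_apply] at heq
  rw [Minkowski.bilin_symm udot] at heq
  linarith

/-- **The rest-frame image of `u̇` is spatial**: `(Λ₀⁻¹ u̇)⁰ = 0`, because
`η(e₀, Λ₀⁻¹u̇) = η(Λ₀e₀, u̇) = 0`. [cite: ONeill1983, Ch. 9, p. 233] -/
theorem lorentz_symm_deriv_vel_apply_zero
    (hu : HasDerivAt (fun s ↦ (Λ s : E4 ≃L[ℝ] E4) (E4.ofTimeSpace 1 0)) udot s₀) :
    ((Λ s₀ : E4 ≃L[ℝ] E4).symm udot) 0 = 0 := by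
  have h := minkowski_vel_deriv_vel_eq_zero hu
  have h2 : Minkowski.bilin ((Λ s₀ : E4 ≃L[ℝ] E4) (E4.ofTimeSpace 1 0)) udot =
      Minkowski.bilin (E4.ofTimeSpace 1 0) ((Λ s₀ : E4 ≃L[ℝ] E4).symm udot) := by
    conv_lhs => rw [← (Λ s₀ : E4 ≃L[ℝ] E4).apply_symm_apply udot]
    exact (Λ s₀).2 _ _
  rw [h2, Kerr.minkowski_bilin_eq_spatial] at h
  simpa using h

/-- **`D u₀ = −Λ₀⁻¹ u̇`**: differentiate `Λ(s)⁻¹ (Λ(s) e₀) = e₀`. [cite: ONeill1983, Ch. 9, p. 233] -/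
theorem deriv_symm_vel_eq_neg
    (hΛ : HasDerivAt (fun s ↦ (((Λ s : E4 ≃L[ℝ] E4).symm : E4 →L[ℝ] E4))) D s₀)
    (hu : HasDerivAt (fun s ↦ (Λ s : E4 ≃L[ℝ] E4) (E4.ofTimeSpace 1 0)) udot s₀) :
    D ((Λ s₀ : E4 ≃L[ℝ] E4) (E4.ofTimeSpace 1 0)) = -((Λ s₀ : E4 ≃L[ℝ] E4).symm udot) := by
  have h := hΛ.clm_apply hu
  have hconst : (fun s ↦ (((Λ s : E4 ≃L[ℝ] E4).symm : E4 →L[ℝ] E4))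
      ((Λ s : E4 ≃L[ℝ] E4) (E4.ofTimeSpace 1 0))) = fun _ ↦ E4.ofTimeSpace 1 0 := by
    funext s
    exact (Λ s : E4 ≃L[ℝ] E4).symm_apply_apply _
  have hzero : HasDerivAt (fun s ↦ (((Λ s : E4 ≃L[ℝ] E4).symm : E4 →L[ℝ] E4))
      ((Λ s : E4 ≃L[ℝ] E4) (E4.ofTimeSpace 1 0))) 0 s₀ := by
    rw [hconst]; exact hasDerivAt_const s₀ _
  have heq := h.unique hzero
  rw [add_eq_zero_iff_eq_neg] at heq
  simpa using heq

/-- **`(D u₀)⃗ = 0 ⇒ u̇ = 0`**: `D u₀ = −Λ₀⁻¹u̇` is spatial (`(Λ₀⁻¹u̇)⁰ = 0`), so it vanishes, and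
`Λ₀⁻¹` is injective. [cite: ONeill1983, Ch. 9, p. 233] -/
theorem deriv_vel_eq_zero_of_spatial_eq_zero
    (hΛ : HasDerivAt (fun s ↦ (((Λ s : E4 ≃L[ℝ] E4).symm : E4 →L[ℝ] E4))) D s₀)
    (hu : HasDerivAt (fun s ↦ (Λ s : E4 ≃L[ℝ] E4) (E4.ofTimeSpace 1 0)) udot s₀)
    (h : E4.spatial (D ((Λ s₀ : E4 ≃L[ℝ] E4) (E4.ofTimeSpace 1 0))) = 0) : udot = 0 := by
  have h1 := deriv_symm_vel_eq_neg hΛ hu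
  have h0 := lorentz_symm_deriv_vel_apply_zero hu
  have hsp : E4.spatial ((Λ s₀ : E4 ≃L[ℝ] E4).symm udot) = 0 := by
    rw [h1, map_neg, neg_eq_zero] at h
    exact h
  have hy : (Λ s₀ : E4 ≃L[ℝ] E4).symm udot = 0 := by
    have h2 := E4.ofTimeSpace_time_spatial ((Λ s₀ : E4 ≃L[ℝ] E4).symm udot)
    rw [hsp, show E4.time ((Λ s₀ : E4 ≃L[ℝ] E4).symm udot) = 0 from h0] at h2
    rw [← h2]
    ext i
    simp [E4.ofTimeSpace]
  simpa using congrArg (Λ s₀ : E4 ≃L[ℝ] E4) hy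

/-- **`(Λ₀⁻¹ ċ)⃗ = 0 ⇒ ċ = ċ′⁰ · u`** with `ċ′⁰ = (Λ₀⁻¹ċ)⁰` the rest-frame time component: the
centre moves with the painted `4`-velocity `u = Λ₀ e₀` (i.e. `ξ̇ = v(Λ)` for `ċ = (1, ξ̇)`).
[cite: ONeill1983, Ch. 9, p. 233] -/
theorem eq_smul_vel_of_spatial_symm_eq_zero (Λ₀ : lorentzGroup) (cdot : E4)
    (h : E4.spatial ((Λ₀ : E4 ≃L[ℝ] E4).symm cdot) = 0) :
    cdot = ((Λ₀ : E4 ≃L[ℝ] E4).symm cdot) 0 • (Λ₀ : E4 ≃L[ℝ] E4) (E4.ofTimeSpace 1 0) := by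
  have h2 := E4.ofTimeSpace_time_spatial ((Λ₀ : E4 ≃L[ℝ] E4).symm cdot)
  rw [h] at h2
  have h3 : (Λ₀ : E4 ≃L[ℝ] E4).symm cdot = E4.time ((Λ₀ : E4 ≃L[ℝ] E4).symm cdot) • E4.ofTimeSpace 1 0 := by
    rw [← h2]
    ext i
    refine Fin.cases ?_ (fun j ↦ ?_) i <;> simp [E4.ofTimeSpace, E4.time]
  have h4 := congrArg (Λ₀ : E4 ≃L[ℝ] E4) h3
  rw [ContinuousLinearEquiv.apply_symm_apply, map_smul] at h4
  exact h4

/-- **Four-event rigidity along a motion, in the painted jets.** Under the hypotheses of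
`spatial_eq_zero_of_deriv_boostedKerrBilin_eq_zero_four_events` (first variation of the painted
Schwarzschild summand vanishing at four lab events whose rest images are off the time axis and in
general position), the painted `4`-velocity `u = Λ e₀` is instantaneously constant, `u̇(s₀) = 0`, and
the centre moves with it, `ċ = (Λ₀⁻¹ċ)⁰ · u₀` — the slaving jets `(u̇, ξ̇ − v(Λ))` vanish at `s₀`.
[cite: KerrSchild1965, §2] -/
theorem deriv_vel_eq_zero_and_of_deriv_boostedKerrBilin_eq_zero_four_events {c : ℝ → E4} {M : ℝ}
    {cdot : E4} (hM : M ≠ 0)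
    (hΛ : HasDerivAt (fun s ↦ (((Λ s : E4 ≃L[ℝ] E4).symm : E4 →L[ℝ] E4))) D s₀)
    (hc : HasDerivAt c cdot s₀)
    (hu : HasDerivAt (fun s ↦ (Λ s : E4 ≃L[ℝ] E4) (E4.ofTimeSpace 1 0)) udot s₀) (x : Fin 4 → E4)
    (hx : ∀ k, E4.spatial (poincareInv (Λ s₀) (c s₀) (x k)) ≠ 0)
    (hind : ∀ i j k : Fin 4, i ≠ j → j ≠ k → i ≠ k →
      LinearIndependent ℝ ![E4.spatial (poincareInv (Λ s₀) (c s₀) (x i)),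
        E4.spatial (poincareInv (Λ s₀) (c s₀) (x j)), E4.spatial (poincareInv (Λ s₀) (c s₀) (x k))])
    (h : ∀ k, ∀ v w : E4, deriv (fun s ↦ boostedKerrBilin (Λ s) (c s) M 0 (x k) v w) s₀ = 0) :
    udot = 0 ∧ cdot = ((Λ s₀ : E4 ≃L[ℝ] E4).symm cdot) 0 • (Λ s₀ : E4 ≃L[ℝ] E4) (E4.ofTimeSpace 1 0) := by
  obtain ⟨h1, h2⟩ := spatial_eq_zero_of_deriv_boostedKerrBilin_eq_zero_four_events hM hΛ hc x hx hind h
  refine ⟨deriv_vel_eq_zero_of_spatial_eq_zero hΛ hu h1, eq_smul_vel_of_spatial_symm_eq_zero _ _ ?_⟩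
  simpa using h2

end Kinematics

/-- **Registered one-line carrier form** (`coer_motion_rigidity_jets_s0`) of
`deriv_vel_eq_zero_and_of_deriv_boostedKerrBilin_eq_zero_four_events`. [cite: KerrSchild1965, §2] -/
theorem coer_motion_rigidity_jets_s0 : open Literature.Geometry.Lorentzian in ∀ {Λ : ℝ → lorentzGroup} {s₀ : ℝ} {D : E4 →L[ℝ] E4} {udot : E4} {c : ℝ → E4} {M : ℝ} {cdot : E4}, M ≠ 0 → HasDerivAt (fun s ↦ (((Λ s : E4 ≃L[ℝ] E4).symm : E4 →L[ℝ] E4))) D s₀ → HasDerivAt c cdot s₀ → HasDerivAt (fun s ↦ (Λ s : E4 ≃L[ℝ] E4) (E4.ofTimeSpace 1 0)) udot s₀ → ∀ (x : Fin 4 → E4), (∀ k, E4.spatial (poincareInv (Λ s₀) (c s₀) (x k)) ≠ 0) → (∀ i j k : Fin 4, i ≠ j → j ≠ k → i ≠ k → LinearIndependent ℝ ![E4.spatial (poincareInv (Λ s₀) (c s₀) (x i)), E4.spatial (poincareInv (Λ s₀) (c s₀) (x j)), E4.spatial (poincareInv (Λ s₀) (c s₀) (x k))]) → (∀ k, ∀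 v w : E4, deriv (fun s ↦ boostedKerrBilin (Λ s) (c s) M 0 (x k) v w) s₀ = 0) → udot = 0 ∧ cdot = ((Λ s₀ : E4 ≃L[ℝ] E4).symm cdot) 0 • (Λ s₀ : E4 ≃L[ℝ] E4) (E4.ofTimeSpace 1 0) :=
  fun hM hΛ hc hu x hx hind h ↦
    deriv_vel_eq_zero_and_of_deriv_boostedKerrBilin_eq_zero_four_events hM hΛ hc hu x hx hind h

end Summit.FinalStateConjecture.FinalStateConjecture.Theorems.SublinearIsFree.Slaving
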